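import Mathlib
import Summits.NavierStokesRegularity.FluidComputer.AbcClassIIBasesPrep

/-!
# GROUP-B END-TO-END ON THE MODEL, CLASS II — ARBITRARY **COMPLEX** (UNITARY) ORBIT BASES (prep 1):
# the unitary change of basis, expansion, band and growth of the complex first-order matrix `amc`
(profile-cert-3 g8, cell `ns-blowup`, 2026-08-27)

HONEST FRAMING (human rulings D-0035/D-0074): nothing here is a claim about Navier–Stokes blow-up.
WHAT THIS IS NOT: not NS evidence. MODEL lane (NS linearised about the forced ABC flow `abcFlow 1 1 1`,
class II); no certificate, number or census word moves.

WHY (g8 FINDING): implementation 3 of the 3-B-nested certifier (cert3.py / abcsym3.py) computes in a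
COMPLEX orthonormal basis of the class-II orbit spaces — Gaussian-integer fields supported on ONE orbit of
the 24-element proper symmetry group, hence NOT conjugate-symmetric on the split signed-permutation orbits
— so the real-bases theorems (`…_of_bases`, instab4 g7 / cert-3 g7: `e O : OrthonormalBasis … ℝ (realSpace O)`)
do not read its rows. This file starts the complex analogue. DATA: a family `wf : Idx → Fam` with, per
index `i = ⟨O, a⟩`, `wf i` supported in `O`, transversal, class II (no conjugate symmetry), and per orbit
complex-orthonormal: `Σ_{k∈O} ⟪wf ⟨O,a⟩ k, wf ⟨O,b⟩ k⟫ = δ_ab`, `odim O` vectors per orbit (the index type);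
i.e. a family of orthonormal bases of the complexifications `realSpace O ⊗ ℂ = {transversal ∧ class II on O}`
(instab4 `AbcClassIIBasis.expand_complex`). With `U_O a b := Σ_{k∈O} ⟪bfam ⟨O,a⟩ k, wf ⟨O,b⟩ k⟫` (complex):
* `cwf_expand`: `wf ⟨O,b⟩ = Σ_a U_O a b • bfam ⟨O,a⟩` (`expand_complex`);
* `cU_orth_cols` / `cU_orth_rows`: `U_Oᴴ U_O = 1 = U_O U_Oᴴ` entrywise (orthonormality of `wf` and of `bfam`;
  `mul_eq_one_comm` for the square matrix);
* `camc_eq`: the complex first-order matrix `amc i j := Σ_{k∈O_i} ⟪wf i k, Π_k X(wf j)(k)⟫` equals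
  `Σ_{a a'} conj(U a i.2) · U a' j.2 · amat ⟨O_i,a⟩ ⟨O_j,a'⟩`;
* `camc_eq_zero_of_not_mem` (BAND), `norm_camc_le` (GROWTH `‖amc i j‖ ≤ 288 · 2592 √(1 + |O_j|²)`);
* `cQ_eq_zero_of_ne`, `cQ_same`, `sum_saturated_complex`, `sum_cQ_cols`, `camc_eq_sum`: the coefficients as a
  kernel on `Idx × Idx`, column-orthonormal on orbit-saturated index sets, and `amc = Qᴴ amat Q` there.
Mathlib + `AbcClassIIBasesPrep` (transitively the class-II layer); no new definitions. bears_on LADDER-NS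
N5 / Z4-a(1) (F5 caveat (iii‴) for implementation 3). [folklore].
-/

noncomputable section

open scoped BigOperators ComplexConjugate InnerProductSpace Matrix
open Finset Matrix

namespace Summit.NavierStokesRegularity.FluidComputer.AbcClassIIEigenpair

open Literature.Analysis.FunctionSpaces Literature.Analysis.FunctionSpaces.Torus
open Literature.Analysis.FunctionSpaces.EuclideanSpace
open Literature.Analysis.FluidPDE Literature.Analysis.FluidPDE.SteadyLattice
open Summit.NavierStokesRegularity.FluidComputer.AbcClassII

section ComplexBasesPrep

variable (wf : Idx → Fam)
variable (hws : ∀ i : Idx, ∀ k ∉ i.1.1, wf i k = 0)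
variable (hwt : ∀ (i : Idx) (k : Fin 3 → ℤ), ∑ j : Fin 3, ((k j : ℤ) : ℂ) * wf i k j = 0)
variable (hwII : ∀ i : Idx, IsClassII (wf i))
variable (hwon : ∀ (O : Orbit) (a b : Fin (odim O)),
  ∑ k ∈ O.1, (inner ℂ (wf ⟨O, a⟩ k) (wf ⟨O, b⟩ k) : ℂ) = if a = b then 1 else 0)
variable (amc : Idx → Idx → ℂ)
variable (hamc : ∀ i j : Idx, amc i j =
  ∑ k ∈ i.1.1, (inner ℂ (wf i k) (Torus.lerayCoeff k (crossForm 1 1 1 (wf j) k)) : ℂ))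

/-! ### §1 Expansion of the complex basis families in the existential real one -/

section
include hws hwt hwII

/-- **Expansion**: `wf ⟨O,b⟩ = Σ_a U_O a b • bfam ⟨O,a⟩` with `U_O a b = Σ_{k∈O} ⟪bfam ⟨O,a⟩ k, wf ⟨O,b⟩ k⟫`
(complex completeness of the class-II orbit space, instab4 `expand_complex`). -/
theorem cwf_expand (O : Orbit) (b : Fin (odim O)) :
    wf ⟨O, b⟩ = ∑ a : Fin (odim O),
      (∑ k ∈ O.1, (inner ℂ (bfam ⟨O, a⟩ k) (wf ⟨O, b⟩ k) : ℂ)) • bfam ⟨O, a⟩ :=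
  expand_complex O (hws ⟨O, b⟩) (hwt ⟨O, b⟩) (hwII ⟨O, b⟩)

/-- The expansion, evaluated at a frequency. -/
theorem cwf_expand_apply (O : Orbit) (b : Fin (odim O)) (k : Fin 3 → ℤ) :
    wf ⟨O, b⟩ k = ∑ a : Fin (odim O),
      (∑ k' ∈ O.1, (inner ℂ (bfam ⟨O, a⟩ k') (wf ⟨O, b⟩ k') : ℂ)) • bfam ⟨O, a⟩ k := by
  conv_lhs => rw [cwf_expand wf hws hwt hwII O b]
  exact sum_smul_bfam_apply (Finset.univ) (fun a : Fin (odim O) => (⟨O, a⟩ : Idx)) _ k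

end

/-! ### §2 Unitarity of the change of basis -/

section
include hws hwt hwII hwon

/-- **Column orthonormality** `Σ_a conj(U a b) · U a b' = δ_{b b'}` (orthonormality of `wf` on the orbit,
expanded in the orthonormal `bfam`). -/
theorem cU_orth_cols (O : Orbit) (b b' : Fin (odim O)) :
    ∑ a : Fin (odim O), conj (∑ k ∈ O.1, (inner ℂ (bfam ⟨O, a⟩ k) (wf ⟨O, b⟩ k) : ℂ)) *
        (∑ k ∈ O.1, (inner ℂ (bfam ⟨O, a⟩ k) (wf ⟨O, b'⟩ k) : ℂ)) = if b = b' then 1 else 0 := by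
  set U : Fin (odim O) → Fin (odim O) → ℂ := fun a b =>
    ∑ k ∈ O.1, (inner ℂ (bfam ⟨O, a⟩ k) (wf ⟨O, b⟩ k) : ℂ) with hU
  have hb := cwf_expand_apply wf hws hwt hwII O b
  have hb' := cwf_expand_apply wf hws hwt hwII O b'
  have h := hwon O b b'
  have e1 : ∀ k, (inner ℂ (wf ⟨O, b⟩ k) (wf ⟨O, b'⟩ k) : ℂ) =
      ∑ a : Fin (odim O), ∑ a' : Fin (odim O), conj (U a b) * U a' b' *
        (inner ℂ (bfam ⟨O, a⟩ k) (bfam ⟨O, a'⟩ k) : ℂ) := by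
    intro k
    rw [hb k, hb' k, sum_inner]
    refine Finset.sum_congr rfl fun a _ => ?_
    rw [inner_sum]
    refine Finset.sum_congr rfl fun a' _ => ?_
    rw [inner_smul_left, inner_smul_right]
    ring
  rw [Finset.sum_congr rfl fun k _ => e1 k, Finset.sum_comm] at h
  have e2 : ∀ a : Fin (odim O), ∑ k ∈ O.1, ∑ a' : Fin (odim O), conj (U a b) * U a' b' *
      (inner ℂ (bfam ⟨O, a⟩ k) (bfam ⟨O, a'⟩ k) : ℂ) = conj (U a b) * U a b' := by
    intro a
    rw [Finset.sum_comm]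
    have e3 : ∀ a' : Fin (odim O), ∑ k ∈ O.1, conj (U a b) * U a' b' *
        (inner ℂ (bfam ⟨O, a⟩ k) (bfam ⟨O, a'⟩ k) : ℂ) =
        conj (U a b) * U a' b' * (if a = a' then 1 else 0) := fun a' => by
      rw [← Finset.mul_sum, sum_inner_bfam_same_orbit O a a']
    rw [Finset.sum_congr rfl fun a' _ => e3 a']
    rw [Finset.sum_eq_single a (fun a' _ hne => by rw [if_neg (Ne.symm hne), mul_zero])
      (fun ha => absurd (Finset.mem_univ a) ha), if_pos rfl, mul_one]
  rw [Finset.sum_congr rfl fun a _ => e2 a] at h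
  exact h

/-- **Row orthonormality** `Σ_b U a b · conj(U a' b) = δ_{a a'}` (a square matrix with orthonormal columns
is unitary: `mul_eq_one_comm`). -/
theorem cU_orth_rows (O : Orbit) (a a' : Fin (odim O)) :
    ∑ b : Fin (odim O), (∑ k ∈ O.1, (inner ℂ (bfam ⟨O, a⟩ k) (wf ⟨O, b⟩ k) : ℂ)) *
        conj (∑ k ∈ O.1, (inner ℂ (bfam ⟨O, a'⟩ k) (wf ⟨O, b⟩ k) : ℂ)) = if a = a' then 1 else 0 := by
  set U : Matrix (Fin (odim O)) (Fin (odim O)) ℂ := Matrix.of fun a b =>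
    ∑ k ∈ O.1, (inner ℂ (bfam ⟨O, a⟩ k) (wf ⟨O, b⟩ k) : ℂ) with hU
  have hcols : Uᴴ * U = 1 := by
    ext b b'
    rw [Matrix.mul_apply, Matrix.one_apply]
    have h := cU_orth_cols wf hws hwt hwII hwon O b b'
    refine Eq.trans (Finset.sum_congr rfl fun a _ => ?_) h
    rw [Matrix.conjTranspose_apply, hU, Matrix.of_apply, Matrix.of_apply, RCLike.star_def]
  have hrows : U * Uᴴ = 1 := mul_eq_one_comm.mp hcols
  have h := congrFun (congrFun hrows a) a'
  rw [Matrix.mul_apply, Matrix.one_apply] at h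
  refine Eq.trans (Finset.sum_congr rfl fun b _ => ?_) h
  rw [Matrix.conjTranspose_apply, hU, Matrix.of_apply, Matrix.of_apply, RCLike.star_def]

/-- The columns of `U_O` have `ℓ²`-norm one: `Σ_a ‖U a b‖² = 1`. -/
theorem sum_norm_sq_cU (O : Orbit) (b : Fin (odim O)) :
    ∑ a : Fin (odim O), ‖∑ k ∈ O.1, (inner ℂ (bfam ⟨O, a⟩ k) (wf ⟨O, b⟩ k) : ℂ)‖ ^ 2 = 1 := by
  have h := cU_orth_cols wf hws hwt hwII hwon O b b
  rw [if_pos rfl] at h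
  have h' : ((∑ a : Fin (odim O), ‖∑ k ∈ O.1, (inner ℂ (bfam ⟨O, a⟩ k) (wf ⟨O, b⟩ k) : ℂ)‖ ^ 2 : ℝ) : ℂ) =
      (1 : ℂ) := by
    rw [← h]
    push_cast
    refine Finset.sum_congr rfl fun a _ => ?_
    rw [mul_comm, Complex.mul_conj, Complex.normSq_eq_norm_sq]
    push_cast
    ring
  exact_mod_cast h'

/-- The columns of `U_O` have `ℓ¹`-norm `≤ √288` (Cauchy–Schwarz, `odim O ≤ 288`). -/
theorem sum_norm_cU_le (O : Orbit) (b : Fin (odim O)) :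
    ∑ a : Fin (odim O), ‖∑ k ∈ O.1, (inner ℂ (bfam ⟨O, a⟩ k) (wf ⟨O, b⟩ k) : ℂ)‖ ≤ Real.sqrt 288 := by
  set U : Fin (odim O) → ℂ := fun a => ∑ k ∈ O.1, (inner ℂ (bfam ⟨O, a⟩ k) (wf ⟨O, b⟩ k) : ℂ) with hU
  have h1 := Finset.sum_mul_sq_le_sq_mul_sq (Finset.univ : Finset (Fin (odim O)))
    (fun a => ‖U a‖) (fun _ => (1 : ℝ))
  have h2 : ∑ a : Fin (odim O), ‖U a‖ ^ 2 = 1 := sum_norm_sq_cU wf hws hwt hwII hwon O b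
  have h3 : ∑ _a : Fin (odim O), (1 : ℝ) ^ 2 = (odim O : ℝ) := by simp
  have h4 : (odim O : ℝ) ≤ 288 := by exact_mod_cast odim_le O
  simp only [mul_one] at h1
  rw [h2, h3, one_mul] at h1
  have h5 : 0 ≤ ∑ a : Fin (odim O), ‖U a‖ := Finset.sum_nonneg fun _ _ => norm_nonneg _
  calc ∑ a : Fin (odim O), ‖U a‖ = Real.sqrt ((∑ a : Fin (odim O), ‖U a‖) ^ 2) := (Real.sqrt_sq h5).symm
    _ ≤ Real.sqrt 288 := Real.sqrt_le_sqrt (h1.trans h4)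

end

/-! ### §3 The complex first-order matrix expanded in the existential basis; band; growth -/

section
include hws hwt hwII hamc

/-- **`amc = Uᴴ amat U` orbitwise**:
`amc i j = Σ_{a, a'} conj(U_{O_i} a i.2) · U_{O_j} a' j.2 · amat ⟨O_i,a⟩ ⟨O_j,a'⟩`. -/
theorem camc_eq (i j : Idx) :
    amc i j = ∑ a : Fin (odim i.1), ∑ a' : Fin (odim j.1),
      conj (∑ k ∈ i.1.1, (inner ℂ (bfam ⟨i.1, a⟩ k) (wf ⟨i.1, i.2⟩ k) : ℂ)) *
        (∑ k ∈ j.1.1, (inner ℂ (bfam ⟨j.1, a'⟩ k) (wf ⟨j.1, j.2⟩ k) : ℂ)) *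
          ((amat ⟨i.1, a⟩ ⟨j.1, a'⟩ : ℝ) : ℂ) := by
  obtain ⟨O, b⟩ := i
  obtain ⟨O', b'⟩ := j
  set U : Fin (odim O) → ℂ := fun a => ∑ k ∈ O.1, (inner ℂ (bfam ⟨O, a⟩ k) (wf ⟨O, b⟩ k) : ℂ) with hU
  set U' : Fin (odim O') → ℂ := fun a' => ∑ k ∈ O'.1, (inner ℂ (bfam ⟨O', a'⟩ k) (wf ⟨O', b'⟩ k) : ℂ)
    with hU'
  have hi := cwf_expand wf hws hwt hwII O b
  have hj := cwf_expand wf hws hwt hwII O' b'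
  rw [hamc]
  change ∑ k ∈ O.1, (inner ℂ (wf ⟨O, b⟩ k) (Torus.lerayCoeff k (crossForm 1 1 1 (wf ⟨O', b'⟩) k)) : ℂ) =
    ∑ a : Fin (odim O), ∑ a' : Fin (odim O'), conj (U a) * U' a' * ((amat ⟨O, a⟩ ⟨O', a'⟩ : ℝ) : ℂ)
  have e1 : ∀ k, (inner ℂ (wf ⟨O, b⟩ k) (Torus.lerayCoeff k (crossForm 1 1 1 (wf ⟨O', b'⟩) k)) : ℂ) =
      ∑ a : Fin (odim O), ∑ a' : Fin (odim O'), conj (U a) * U' a' *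
        (inner ℂ (bfam ⟨O, a⟩ k) (Torus.lerayCoeff k (crossForm 1 1 1 (bfam ⟨O', a'⟩) k)) : ℂ) := by
    intro k
    rw [hj, lerayCrossForm_sum_smul (Finset.univ) (fun a' : Fin (odim O') => (⟨O', a'⟩ : Idx))
      (fun a' => U' a') k, hi,
      sum_smul_bfam_apply (Finset.univ) (fun a : Fin (odim O) => (⟨O, a⟩ : Idx)) (fun a => U a) k,
      sum_inner]
    refine Finset.sum_congr rfl fun a _ => ?_
    rw [inner_sum]
    refine Finset.sum_congr rfl fun a' _ => ?_
    rw [inner_smul_left, inner_smul_right]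
    ring
  rw [Finset.sum_congr rfl fun k _ => e1 k, Finset.sum_comm]
  refine Finset.sum_congr rfl fun a _ => ?_
  rw [Finset.sum_comm]
  refine Finset.sum_congr rfl fun a' _ => ?_
  rw [← Finset.mul_sum, ← amat_eq ⟨O, a⟩ ⟨O', a'⟩]

/-- **BAND in complex orbit bases**: `amc i j = 0` unless `j ∈ nbrIdx i`. -/
theorem camc_eq_zero_of_not_mem {i j : Idx} (h : j ∉ nbrIdx i) : amc i j = 0 := by
  rw [camc_eq wf hws hwt hwII amc hamc i j]
  refine Finset.sum_eq_zero fun a _ => Finset.sum_eq_zero fun a' _ => ?_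
  have h' : (⟨j.1, a'⟩ : Idx) ∉ nbrIdx (⟨i.1, a⟩ : Idx) := fun hm => by
    have h2 : j.1 ∈ nbrOrbits i.1 := (mem_nbrIdx (i := (⟨i.1, a⟩ : Idx)) (j := ⟨j.1, a'⟩)).mp hm
    exact h (mem_nbrIdx.mpr h2)
  rw [amat_eq_zero_of_not_mem h', Complex.ofReal_zero, mul_zero]

end

section
include hws hwt hwII hwon hamc

/-- **GROWTH in complex orbit bases**: `‖amc i j‖ ≤ 288 · 2592 √(1 + |O_j|²)`. -/
theorem norm_camc_le (i j : Idx) : ‖amc i j‖ ≤ 288 * (2592 * Real.sqrt (1 + onormSq j.1)) := by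
  rw [camc_eq wf hws hwt hwII amc hamc i j]
  set U : Fin (odim i.1) → ℂ := fun a => ∑ k ∈ i.1.1, (inner ℂ (bfam ⟨i.1, a⟩ k) (wf ⟨i.1, i.2⟩ k) : ℂ)
    with hU
  set U' : Fin (odim j.1) → ℂ := fun a' => ∑ k ∈ j.1.1, (inner ℂ (bfam ⟨j.1, a'⟩ k) (wf ⟨j.1, j.2⟩ k) : ℂ)
    with hU'
  set G := 2592 * Real.sqrt (1 + onormSq j.1) with hG
  have hG0 : 0 ≤ G := by positivity
  calc ‖∑ a : Fin (odim i.1), ∑ a' : Fin (odim j.1), conj (U a) * U' a' * ((amat ⟨i.1, a⟩ ⟨j.1, a'⟩ : ℝ) : ℂ)‖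
      ≤ ∑ a : Fin (odim i.1), ∑ a' : Fin (odim j.1), ‖U a‖ * ‖U' a'‖ * G := by
        refine (norm_sum_le _ _).trans (Finset.sum_le_sum fun a _ => ?_)
        refine (norm_sum_le _ _).trans (Finset.sum_le_sum fun a' _ => ?_)
        rw [norm_mul, norm_mul, Complex.norm_conj, Complex.norm_real, Real.norm_eq_abs]
        exact mul_le_mul_of_nonneg_left (abs_amat_le ⟨i.1, a⟩ ⟨j.1, a'⟩) (by positivity)
    _ = (∑ a : Fin (odim i.1), ‖U a‖) * (∑ a' : Fin (odim j.1), ‖U' a'‖) * G := by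
        symm
        rw [Finset.sum_mul_sum, Finset.sum_mul]
        exact Finset.sum_congr rfl fun a _ => by rw [Finset.sum_mul]
    _ ≤ Real.sqrt 288 * Real.sqrt 288 * G :=
        mul_le_mul_of_nonneg_right (mul_le_mul (sum_norm_cU_le wf hws hwt hwII hwon i.1 i.2)
          (sum_norm_cU_le wf hws hwt hwII hwon j.1 j.2) (Finset.sum_nonneg fun _ _ => norm_nonneg _)
          (Real.sqrt_nonneg _)) hG0
    _ = 288 * G := by rw [Real.mul_self_sqrt (by norm_num)]

end

/-! ### §4 The coefficients as a kernel on `Idx × Idx`; orbit-saturated index sets -/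

section
include hws

/-- Across different orbits the complex coefficients vanish (disjoint supports). -/
theorem cQ_eq_zero_of_ne {i j : Idx} (h : i.1 ≠ j.1) :
    ∑ k ∈ i.1.1, (inner ℂ (bfam i k) (wf j k) : ℂ) = 0 := by
  refine Finset.sum_eq_zero fun k hk => ?_
  have hk' : k ∉ j.1.1 := fun h' => Finset.disjoint_left.mp (Orbit.disjoint_of_ne h) hk h'
  rw [hws j k hk', inner_zero_right]

end

/-- **Sums over an orbit-saturated index set of a complex function living on one orbit** are sums over
the basis index of that orbit (complex-valued version of instab4's `sum_saturated`). -/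
theorem sum_saturated_complex {T : Finset Idx} (O : Orbit) (hTO : ∀ a : Fin (odim O), (⟨O, a⟩ : Idx) ∈ T)
    (g : Idx → ℂ) (hg : ∀ i : Idx, i.1 ≠ O → g i = 0) :
    ∑ i ∈ T, g i = ∑ a : Fin (odim O), g ⟨O, a⟩ := by
  classical
  set SO : Finset Idx := (Finset.univ : Finset (Fin (odim O))).map
    ⟨fun a => (⟨O, a⟩ : Idx), fun a b h => eq_of_heq (Sigma.mk.inj_iff.mp h).2⟩ with hSO
  have hsub : SO ⊆ T := by
    intro i hi
    obtain ⟨a, -, rfl⟩ := Finset.mem_map.mp hi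
    exact hTO a
  rw [← Finset.sum_subset hsub fun i _ hi => hg i fun h => hi ?_, Finset.sum_map]
  · rfl
  · obtain ⟨O', a⟩ := i
    change O' = O at h
    subst h
    exact Finset.mem_map.mpr ⟨a, Finset.mem_univ _, rfl⟩

section
include hws hwt hwII hwon

/-- **Column orthonormality of the coefficient kernel on a saturated index set**:
`Σ_{i ∈ T} conj(Q i j) · Q i j' = δ_{j j'}` for `j, j' ∈ T`. -/
theorem sum_cQ_cols {T : Finset Idx} (hT : ∀ i ∈ T, ∀ a : Fin (odim i.1), (⟨i.1, a⟩ : Idx) ∈ T)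
    {j j' : Idx} (hj : j ∈ T) (hj' : j' ∈ T) :
    ∑ i ∈ T, conj (∑ k ∈ i.1.1, (inner ℂ (bfam i k) (wf j k) : ℂ)) *
        (∑ k ∈ i.1.1, (inner ℂ (bfam i k) (wf j' k) : ℂ)) = if j = j' then 1 else 0 := by
  obtain ⟨O, b⟩ := j
  obtain ⟨O', b'⟩ := j'
  by_cases hO : O = O'
  · subst hO
    rw [sum_saturated_complex O (hT _ hj) _ fun i hi => by
      rw [cQ_eq_zero_of_ne wf hws (j := ⟨O, b⟩) hi, map_zero, zero_mul]]
    have h := cU_orth_cols wf hws hwt hwII hwon O b b'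
    refine Eq.trans h ?_
    by_cases hb : b = b'
    · subst hb; simp
    · rw [if_neg hb]
      exact (if_neg (show (⟨O, b⟩ : Idx) ≠ ⟨O, b'⟩ from fun h => hb (eq_of_heq (Sigma.mk.inj_iff.mp h).2))).symm
  · refine Eq.trans ?_
      (if_neg (show (⟨O, b⟩ : Idx) ≠ ⟨O', b'⟩ from fun h => hO (Sigma.mk.inj_iff.mp h).1)).symm
    refine Finset.sum_eq_zero fun i _ => ?_
    by_cases h1 : i.1 = O
    · have h2 : i.1 ≠ (⟨O', b'⟩ : Idx).1 := fun h => hO (h1.symm.trans h)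
      rw [cQ_eq_zero_of_ne wf hws (j := ⟨O', b'⟩) h2, mul_zero]
    · have h1' : i.1 ≠ (⟨O, b⟩ : Idx).1 := h1
      rw [cQ_eq_zero_of_ne wf hws (j := ⟨O, b⟩) h1', map_zero, zero_mul]

end

section
include hws hwt hwII hamc

/-- **The complex first-order matrix as a double sum over saturated index sets**: for `j ∈ T₁`, `j' ∈ T₂`,
`amc j j' = Σ_{i ∈ T₁} Σ_{i' ∈ T₂} conj(Q i j) · amat i i' · Q i' j'`. -/
theorem camc_eq_sum {T₁ T₂ : Finset Idx} (hT₁ : ∀ i ∈ T₁, ∀ a : Fin (odim i.1), (⟨i.1, a⟩ : Idx) ∈ T₁)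
    (hT₂ : ∀ i ∈ T₂, ∀ a : Fin (odim i.1), (⟨i.1, a⟩ : Idx) ∈ T₂) {j j' : Idx} (hj : j ∈ T₁) (hj' : j' ∈ T₂) :
    amc j j' = ∑ i ∈ T₁, ∑ i' ∈ T₂, conj (∑ k ∈ i.1.1, (inner ℂ (bfam i k) (wf j k) : ℂ)) *
        ((amat i i' : ℝ) : ℂ) * (∑ k ∈ i'.1.1, (inner ℂ (bfam i' k) (wf j' k) : ℂ)) := by
  rw [camc_eq wf hws hwt hwII amc hamc j j']
  rw [sum_saturated_complex j.1 (hT₁ j hj) _ fun i hi => by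
    rw [Finset.sum_eq_zero fun i' _ => by
      rw [cQ_eq_zero_of_ne wf hws (i := i) (j := j) hi, map_zero, zero_mul, zero_mul]]]
  refine Finset.sum_congr rfl fun a _ => ?_
  rw [sum_saturated_complex j'.1 (hT₂ j' hj') _ fun i' hi' => by
    rw [cQ_eq_zero_of_ne wf hws (i := i') (j := j') hi', mul_zero]]
  refine Finset.sum_congr rfl fun a' _ => ?_
  obtain ⟨O, b⟩ := j
  obtain ⟨O', b'⟩ := j'
  ring

end

end ComplexBasesPrep

end Summit.NavierStokesRegularity.FluidComputer.AbcClassIIEigenpair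

end
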